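import Mathlib
import Literature.Analysis.FluidPDE.GaussianVortexPlanar
import HarnessLib
import Summits.AnomalousDissipation.AnomalousDissipation.Theorems.MarginalStabilityChainStretchedVortexRowsStubLogPotentialTools
import Summits.AnomalousDissipation.AnomalousDissipation.Theorems.MarginalStabilityChainStretchedVortexRowsStubLogPotentialGradient

/-!
# Helper `logPotential_gain_hasFDerivAt` toward the stub `logPotential_gain`
(crux stmt-AnomalousDissipation-3009 `MarginalStabilityChain.StretchedVortexRows`, line `braid-closed-large-circulation-gluing`)

The logarithmic potential `ψ = N ∗ g`, `N = (2π)⁻¹ log ‖·‖`, of a merely **bounded measurable** density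
`|g(η)| ≤ B e^{−‖η‖²/8}` on `ℝ² = EuclideanSpace ℝ (Fin 2)` is differentiable everywhere with the continuous derivative
`Dψ(ξ) = ∫ g(η) DN(ξ − η) dη`, `DN(z) = (2π‖z‖²)⁻¹ ⟪z, ·⟫`: the derivative is *gained from the kernel*.

Route (classical): regularise `N_ε(z) = (4π)⁻¹ log(‖z‖² + ε²)`, `ψ_ε = N_ε ∗ g`.
* `ψ_ε` is differentiable, `Dψ_ε(ξ) = ∫ g(η) DN_ε(ξ − η) dη` with the **bounded** kernel
  `DN_ε(z) = (2π)⁻¹ (‖z‖² + ε²)⁻¹ ⟪z, ·⟫`, `‖DN_ε‖ ≤ (4πε)⁻¹` (differentiation under the integral sign), and `Dψ_ε` is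
  continuous (dominated convergence);
* `Dψ_ε → ∫ g DN(· − η)` **uniformly** on `ℝ²`: `‖DN_ε(z) − DN(z)‖ = (2π)⁻¹ ε² / ((‖z‖² + ε²)‖z‖)` is `≤ (2π)⁻¹‖z‖⁻¹` on the
  unit ball (dominated convergence there) and `≤ (2π)⁻¹ ε²` off it;
* `ψ_ε → ψ` pointwise (dominated convergence, `|log(‖z‖² + ε²)| ≤ 2|log ‖z‖| + ‖z‖²`);
* the uniform-limit-of-derivatives theorem (`hasFDerivAt_of_tendstoUniformly`) along `ε_n = (n+1)⁻¹`.
-/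

set_option linter.dupNamespace false

noncomputable section

open scoped BigOperators Topology RealInnerProductSpace
open Filter Set Function MeasureTheory WithLp Metric

namespace Summit.AnomalousDissipation.AnomalousDissipation.Theorems.MarginalStabilityChainStretchedVortexRows

open Literature.Analysis.FluidPDE

/-! ### The regularised gradient kernel `DN_ε(z) = (2π)⁻¹ (‖z‖² + ε²)⁻¹ ⟪z, ·⟫` -/

/-- `‖c ⟪z, ·⟫‖ = |c| ‖z‖`. [folklore] -/
theorem gain_norm_smul_innerSL (c : ℝ) (z : EuclideanSpace ℝ (Fin 2)) :
    ‖c • innerSL ℝ z‖ = |c| * ‖z‖ := by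
  rw [norm_smul, innerSL_apply_norm, Real.norm_eq_abs]

/-- `‖DN_ε(z)‖ ≤ ‖DN(z)‖ = (2π)⁻¹ ‖z‖⁻¹` for every `ε` (with `0⁻¹ = 0`). [folklore] -/
theorem gain_kernelReg_le_inv (ε : ℝ) (z : EuclideanSpace ℝ (Fin 2)) :
    |(2 * Real.pi)⁻¹ * (‖z‖ ^ 2 + ε ^ 2)⁻¹| * ‖z‖ ≤ (2 * Real.pi)⁻¹ * ‖z‖⁻¹ := by
  rcases eq_or_ne z 0 with rfl | hz
  · simp
  have hn : 0 < ‖z‖ := norm_pos_iff.2 hz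
  have hpos : 0 < ‖z‖ ^ 2 + ε ^ 2 := by positivity
  rw [abs_of_nonneg (by positivity), mul_assoc]
  refine mul_le_mul_of_nonneg_left ?_ (by positivity)
  rw [inv_mul_le_iff₀ hpos, le_mul_inv_iff₀ hn]
  nlinarith [sq_nonneg ε]

/-- The regularised kernel is bounded: `‖DN_ε(z)‖ ≤ (2π)⁻¹ (2ε)⁻¹`. [folklore] -/
theorem gain_kernelReg_le_eps {ε : ℝ} (hε : 0 < ε) (z : EuclideanSpace ℝ (Fin 2)) :
    |(2 * Real.pi)⁻¹ * (‖z‖ ^ 2 + ε ^ 2)⁻¹| * ‖z‖ ≤ (2 * Real.pi)⁻¹ * (2 * ε)⁻¹ := by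
  have hpos : 0 < ‖z‖ ^ 2 + ε ^ 2 := by positivity
  rw [abs_of_nonneg (by positivity), mul_assoc]
  refine mul_le_mul_of_nonneg_left ?_ (by positivity)
  rw [inv_mul_le_iff₀ hpos, le_mul_inv_iff₀ (by positivity : (0:ℝ) < 2 * ε)]
  nlinarith [sq_nonneg (‖z‖ - ε)]

/-- `‖DN_ε(z) − DN(z)‖ = (2π)⁻¹ ε² / ((‖z‖² + ε²) ‖z‖)`. [folklore] -/
theorem gain_kernelReg_sub_kernel (ε : ℝ) (z : EuclideanSpace ℝ (Fin 2)) :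
    |(2 * Real.pi)⁻¹ * (‖z‖ ^ 2 + ε ^ 2)⁻¹ - (2 * Real.pi)⁻¹ * (‖z‖ ^ 2)⁻¹| * ‖z‖ =
      (2 * Real.pi)⁻¹ * (ε ^ 2 / ((‖z‖ ^ 2 + ε ^ 2) * ‖z‖)) := by
  rcases eq_or_ne z 0 with rfl | hz
  · simp
  have hn : 0 < ‖z‖ := norm_pos_iff.2 hz
  have hn' : ‖z‖ ≠ 0 := hn.ne'
  have hpos : 0 < ‖z‖ ^ 2 + ε ^ 2 := by positivity
  rw [← mul_sub, abs_mul, abs_of_pos (by positivity : (0:ℝ) < (2 * Real.pi)⁻¹),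
    inv_sub_inv hpos.ne' (by positivity), abs_div, abs_of_pos (by positivity : (0:ℝ) < (‖z‖ ^ 2 + ε ^ 2) * ‖z‖ ^ 2)]
  have : |‖z‖ ^ 2 - (‖z‖ ^ 2 + ε ^ 2)| = ε ^ 2 := by
    rw [show ‖z‖ ^ 2 - (‖z‖ ^ 2 + ε ^ 2) = -ε ^ 2 by ring, abs_neg, abs_of_nonneg (sq_nonneg ε)]
  rw [this, mul_assoc]
  congr 1
  field_simp

/-- The Gaussian weight `e^{−‖η‖²/8}` is integrable on `ℝ²`. [folklore] -/
theorem gain_integrable_exp :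
    Integrable fun η : EuclideanSpace ℝ (Fin 2) => Real.exp (-(1 / 8) * ‖η‖ ^ 2) := by
  simpa using integrable_one_add_norm_pow_mul_exp_eighth 0

/-! ### The regularised potential of a bounded measurable density -/

section Density

variable {B : ℝ} {g : EuclideanSpace ℝ (Fin 2) → ℝ} (hg : Measurable g)
  (hg0 : ∀ η, |g η| ≤ B * Real.exp (-(1 / 8) * ‖η‖ ^ 2))
include hg hg0

omit hg0 in
/-- Measurability of the integrand `g(η) DN_ε(ξ − η)` (all `ε`, `ε = 0` included). [folklore] -/
theorem gain_aestronglyMeasurable_kernelCLM (ε : ℝ) (ξ : EuclideanSpace ℝ (Fin 2)) :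
    AEStronglyMeasurable (fun η : EuclideanSpace ℝ (Fin 2) =>
      (g η * ((2 * Real.pi)⁻¹ * (‖ξ - η‖ ^ 2 + ε ^ 2)⁻¹)) • innerSL ℝ (ξ - η)) volume := by
  refine (hg.mul ?_).aestronglyMeasurable.smul
    (((innerSL ℝ (E := EuclideanSpace ℝ (Fin 2))).continuous.comp
      (continuous_const.sub continuous_id)).aestronglyMeasurable)
  fun_prop

/-- `N_ε(ξ − ·) g` is integrable for a bounded measurable Gaussian-class `g`. [folklore] -/
theorem gain_integrable_logReg_mul {ε : ℝ} (hε : 0 < ε) (ξ : EuclideanSpace ℝ (Fin 2)) :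
    Integrable fun η : EuclideanSpace ℝ (Fin 2) => (4 * Real.pi)⁻¹ * Real.log (‖ξ - η‖ ^ 2 + ε ^ 2) * g η := by
  -- adapted from `integrable_logReg_mul` (continuity of `g` replaced by measurability)
  set c : ℝ := |Real.log (ε ^ 2)| + 2 * ‖ξ‖ ^ 2 / ε ^ 2 + 2 / ε ^ 2 with hc
  refine (((integrable_one_add_norm_pow_mul_exp_eighth 2).const_mul ((4 * Real.pi)⁻¹ * c * B))).mono' ?_
    (Eventually.of_forall fun η => ?_)
  · exact (((differentiable_logReg_sub hε ξ).continuous.measurable).mul hg).aestronglyMeasurable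
  rw [Real.norm_eq_abs, abs_mul, abs_mul, abs_of_pos (by positivity : (0:ℝ) < (4 * Real.pi)⁻¹)]
  have h1 := abs_log_normSq_add_sq_le hε (ξ - η)
  have h2 : ‖ξ - η‖ ^ 2 ≤ 2 * ‖ξ‖ ^ 2 + 2 * ‖η‖ ^ 2 := by
    have ha : ‖ξ - η‖ ^ 2 ≤ (‖ξ‖ + ‖η‖) ^ 2 := pow_le_pow_left₀ (norm_nonneg _) (norm_sub_le ξ η) 2
    nlinarith [sq_nonneg (‖ξ‖ - ‖η‖)]
  have h3 : |Real.log (‖ξ - η‖ ^ 2 + ε ^ 2)| ≤ c * (1 + ‖η‖) ^ 2 := by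
    have hε2 : 0 < ε ^ 2 := by positivity
    calc |Real.log (‖ξ - η‖ ^ 2 + ε ^ 2)| ≤ |Real.log (ε ^ 2)| + (2 * ‖ξ‖ ^ 2 + 2 * ‖η‖ ^ 2) / ε ^ 2 := by
          refine h1.trans ?_; gcongr
      _ = (|Real.log (ε ^ 2)| + 2 * ‖ξ‖ ^ 2 / ε ^ 2) * 1 + 2 / ε ^ 2 * ‖η‖ ^ 2 := by field_simp; ring
      _ ≤ (|Real.log (ε ^ 2)| + 2 * ‖ξ‖ ^ 2 / ε ^ 2) * (1 + ‖η‖) ^ 2 + 2 / ε ^ 2 * (1 + ‖η‖) ^ 2 := by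
          gcongr <;> nlinarith [norm_nonneg η]
      _ = c * (1 + ‖η‖) ^ 2 := by simp only [hc]; ring
  calc (4 * Real.pi)⁻¹ * |Real.log (‖ξ - η‖ ^ 2 + ε ^ 2)| * |g η|
      ≤ (4 * Real.pi)⁻¹ * (c * (1 + ‖η‖) ^ 2) * (B * Real.exp (-(1 / 8) * ‖η‖ ^ 2)) := by
        gcongr; exact hg0 η
    _ = _ := by ring

/-- The Biot–Savart-type integrand `g(η) DN_ε(ξ − η)` is integrable for every `ε` (`ε = 0` included):
`‖·‖ ≤ (2π)⁻¹ B ‖ξ − η‖⁻¹ e^{−‖η‖²/8}`. [folklore] -/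
theorem gain_integrable_kernelCLM (ε : ℝ) (ξ : EuclideanSpace ℝ (Fin 2)) :
    Integrable fun η : EuclideanSpace ℝ (Fin 2) =>
      (g η * ((2 * Real.pi)⁻¹ * (‖ξ - η‖ ^ 2 + ε ^ 2)⁻¹)) • innerSL ℝ (ξ - η) := by
  have hB : 0 ≤ B := (abs_nonneg _).trans ((hg0 0).trans (le_of_eq (by simp)))
  refine ((integrable_inv_norm_sub_mul_exp ξ).const_mul ((2 * Real.pi)⁻¹ * B)).mono'
    (gain_aestronglyMeasurable_kernelCLM hg ε ξ) (Eventually.of_forall fun η => ?_)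
  rw [gain_norm_smul_innerSL, abs_mul, mul_assoc]
  calc |g η| * (|(2 * Real.pi)⁻¹ * (‖ξ - η‖ ^ 2 + ε ^ 2)⁻¹| * ‖ξ - η‖)
      ≤ B * Real.exp (-(1 / 8) * ‖η‖ ^ 2) * ((2 * Real.pi)⁻¹ * ‖ξ - η‖⁻¹) :=
        mul_le_mul (hg0 η) (gain_kernelReg_le_inv ε _) (by positivity) (by positivity)
    _ = _ := by ring

/-- **Differentiation under the integral sign** for the regularised potential:
`D ψ_ε(ξ₀) = ∫ g(η) DN_ε(ξ₀ − η) dη` (`ε > 0`; dominating function `(4πε)⁻¹ B e^{−‖η‖²/8}`). [folklore] -/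
theorem gain_hasFDerivAt_logReg {ε : ℝ} (hε : 0 < ε) (ξ₀ : EuclideanSpace ℝ (Fin 2)) :
    HasFDerivAt (fun ξ : EuclideanSpace ℝ (Fin 2) => ∫ η, (4 * Real.pi)⁻¹ * Real.log (‖ξ - η‖ ^ 2 + ε ^ 2) * g η)
      (∫ η, (g η * ((2 * Real.pi)⁻¹ * (‖ξ₀ - η‖ ^ 2 + ε ^ 2)⁻¹)) • innerSL ℝ (ξ₀ - η)) ξ₀ := by
  have hB : 0 ≤ B := (abs_nonneg _).trans ((hg0 0).trans (le_of_eq (by simp)))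
  refine hasFDerivAt_integral_of_dominated_of_fderiv_le
    (F' := fun (ξ : EuclideanSpace ℝ (Fin 2)) (η : EuclideanSpace ℝ (Fin 2)) =>
      (g η * ((2 * Real.pi)⁻¹ * (‖ξ - η‖ ^ 2 + ε ^ 2)⁻¹)) • innerSL ℝ (ξ - η))
    (bound := fun η => B * Real.exp (-(1 / 8) * ‖η‖ ^ 2) * ((2 * Real.pi)⁻¹ * (2 * ε)⁻¹))
    univ_mem (Eventually.of_forall fun ξ => (gain_integrable_logReg_mul hg hg0 hε ξ).aestronglyMeasurable)
    (gain_integrable_logReg_mul hg hg0 hε ξ₀) (gain_aestronglyMeasurable_kernelCLM hg ε ξ₀)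
    (Eventually.of_forall fun η ξ _ => ?_) ((gain_integrable_exp.const_mul B).mul_const _)
    (Eventually.of_forall fun η ξ _ => ?_)
  · rw [gain_norm_smul_innerSL, abs_mul, mul_assoc]
    exact mul_le_mul (hg0 η) (gain_kernelReg_le_eps hε _) (by positivity) (by positivity)
  · have h1 : HasFDerivAt (fun ξ : EuclideanSpace ℝ (Fin 2) => (4 * Real.pi)⁻¹ * Real.log (‖ξ - η‖ ^ 2 + ε ^ 2))
        (((2 * Real.pi)⁻¹ * (‖ξ - η‖ ^ 2 + ε ^ 2)⁻¹) • innerSL ℝ (ξ - η)) ξ := by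
      have h := (hasFDerivAt_logReg hε (ξ - η)).comp ξ (hasFDerivAt_sub_const η)
      rwa [ContinuousLinearMap.comp_id] at h
    have h2 := h1.mul_const (g η)
    rwa [smul_smul] at h2

/-- The regularised gradient `ξ ↦ ∫ g(η) DN_ε(ξ − η) dη` is continuous (`ε > 0`). [folklore] -/
theorem gain_continuous_integral_kernelReg {ε : ℝ} (hε : 0 < ε) :
    Continuous fun ξ : EuclideanSpace ℝ (Fin 2) =>
      ∫ η, (g η * ((2 * Real.pi)⁻¹ * (‖ξ - η‖ ^ 2 + ε ^ 2)⁻¹)) • innerSL ℝ (ξ - η) := by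
  have hB : 0 ≤ B := (abs_nonneg _).trans ((hg0 0).trans (le_of_eq (by simp)))
  refine continuous_of_dominated (fun ξ => gain_aestronglyMeasurable_kernelCLM hg ε ξ)
    (fun ξ => Eventually.of_forall fun η => ?_) ((gain_integrable_exp.const_mul B).mul_const
      ((2 * Real.pi)⁻¹ * (2 * ε)⁻¹)) (Eventually.of_forall fun η => ?_)
  · rw [gain_norm_smul_innerSL, abs_mul, mul_assoc]
    exact mul_le_mul (hg0 η) (gain_kernelReg_le_eps hε _) (by positivity) (by positivity)
  · have hc : Continuous fun ξ : EuclideanSpace ℝ (Fin 2) => (‖ξ - η‖ ^ 2 + ε ^ 2)⁻¹ :=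
      (by fun_prop : Continuous fun ξ : EuclideanSpace ℝ (Fin 2) => ‖ξ - η‖ ^ 2 + ε ^ 2).inv₀
        fun ξ => (by positivity : (0:ℝ) < ‖ξ - η‖ ^ 2 + ε ^ 2).ne'
    exact (continuous_const.mul (continuous_const.mul hc)).smul
      ((innerSL ℝ (E := EuclideanSpace ℝ (Fin 2))).continuous.comp (continuous_id.sub continuous_const))

/-- **Uniform convergence of the regularised gradients**: `∫ g DN_{ε_n}(ξ − ·) → ∫ g DN(ξ − ·)` uniformly in
`ξ ∈ ℝ²` along `ε_n = (n+1)⁻¹` (`‖DN_ε − DN‖ ≤ (2π)⁻¹ ‖z‖⁻¹` on the unit ball, `≤ (2π)⁻¹ ε²` off it). [folklore] -/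
theorem gain_tendstoUniformly_fderiv :
    TendstoUniformly
      (fun (n : ℕ) (ξ : EuclideanSpace ℝ (Fin 2)) => ∫ η,
        (g η * ((2 * Real.pi)⁻¹ * (‖ξ - η‖ ^ 2 + (((n:ℝ) + 1)⁻¹) ^ 2)⁻¹)) • innerSL ℝ (ξ - η))
      (fun ξ : EuclideanSpace ℝ (Fin 2) => ∫ η,
        (g η * ((2 * Real.pi)⁻¹ * (‖ξ - η‖ ^ 2)⁻¹)) • innerSL ℝ (ξ - η)) atTop := by
  have hB : 0 ≤ B := (abs_nonneg _).trans ((hg0 0).trans (le_of_eq (by simp)))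
  have h0 : Tendsto (fun n : ℕ => ((n:ℝ) + 1)⁻¹) atTop (𝓝 0) := by
    simpa [one_div] using tendsto_one_div_add_atTop_nhds_zero_nat (𝕜 := ℝ)
  -- the singular part: `h(ε) = ∫_{‖z‖<1} ε²/((‖z‖²+ε²)‖z‖) dz → 0`
  set k : ℕ → EuclideanSpace ℝ (Fin 2) → ℝ := fun n z => (ball (0 : EuclideanSpace ℝ (Fin 2)) 1).indicator
    (fun z => (((n:ℝ) + 1)⁻¹) ^ 2 / ((‖z‖ ^ 2 + (((n:ℝ) + 1)⁻¹) ^ 2) * ‖z‖)) z with hk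
  have hk0 : ∀ n z, 0 ≤ k n z := fun n z => indicator_nonneg (fun z _ => by positivity) z
  have hkle : ∀ n z, k n z ≤ (ball (0 : EuclideanSpace ℝ (Fin 2)) 1).indicator (fun z => ‖z‖⁻¹) z := by
    intro n z
    by_cases hz : z ∈ ball (0 : EuclideanSpace ℝ (Fin 2)) 1
    · simp only [hk, indicator_of_mem hz]
      rcases eq_or_ne z 0 with rfl | hz0
      · simp
      have hn : 0 < ‖z‖ := norm_pos_iff.2 hz0
      have hn' : ‖z‖ ≠ 0 := hn.ne'
      rw [div_le_iff₀ (by positivity)]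
      calc (((n:ℝ) + 1)⁻¹) ^ 2 ≤ ‖z‖ ^ 2 + (((n:ℝ) + 1)⁻¹) ^ 2 := le_add_of_nonneg_left (sq_nonneg _)
        _ = ‖z‖⁻¹ * ((‖z‖ ^ 2 + (((n:ℝ) + 1)⁻¹) ^ 2) * ‖z‖) := by field_simp
    · simp only [hk, indicator_of_notMem hz, le_refl]
  have hkm : ∀ n, AEStronglyMeasurable (k n) volume := fun n =>
    (Measurable.indicator (by fun_prop) measurableSet_ball).aestronglyMeasurable
  have hki : ∀ n, Integrable (k n) := fun n =>
    integrable_indicator_inv_norm.mono' (hkm n) (Eventually.of_forall fun z => by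
      rw [Real.norm_of_nonneg (hk0 n z)]; exact hkle n z)
  have hkt : Tendsto (fun n => ∫ z, k n z) atTop (𝓝 0) := by
    have h := tendsto_integral_of_dominated_convergence (F := k) (f := fun _ => 0)
      ((ball (0 : EuclideanSpace ℝ (Fin 2)) 1).indicator fun z => ‖z‖⁻¹) hkm integrable_indicator_inv_norm
      (fun n => Eventually.of_forall fun z => by rw [Real.norm_of_nonneg (hk0 n z)]; exact hkle n z)
      (Eventually.of_forall fun z => ?_)
    · simpa using h
    by_cases hz : z ∈ ball (0 : EuclideanSpace ℝ (Fin 2)) 1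
    · simp only [hk, indicator_of_mem hz]
      rcases eq_or_ne z 0 with rfl | hz0
      · simp
      have hn : 0 < ‖z‖ := norm_pos_iff.2 hz0
      have h3 : Tendsto (fun n : ℕ => (((n:ℝ) + 1)⁻¹) ^ 2 / ((‖z‖ ^ 2 + (((n:ℝ) + 1)⁻¹) ^ 2) * ‖z‖)) atTop
          (𝓝 (0 ^ 2 / ((‖z‖ ^ 2 + 0 ^ 2) * ‖z‖))) :=
        (h0.pow 2).div (((h0.pow 2).const_add (‖z‖ ^ 2)).mul_const ‖z‖) (by positivity)
      simpa using h3
    · simp only [hk, indicator_of_notMem hz]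
      exact tendsto_const_nhds
  -- the main estimate, uniform in `ξ`
  set I : ℝ := ∫ η : EuclideanSpace ℝ (Fin 2), Real.exp (-(1 / 8) * ‖η‖ ^ 2) with hI
  have hmain : ∀ (n : ℕ) (ξ : EuclideanSpace ℝ (Fin 2)),
      ‖(∫ η, (g η * ((2 * Real.pi)⁻¹ * (‖ξ - η‖ ^ 2)⁻¹)) • innerSL ℝ (ξ - η)) -
        ∫ η, (g η * ((2 * Real.pi)⁻¹ * (‖ξ - η‖ ^ 2 + (((n:ℝ) + 1)⁻¹) ^ 2)⁻¹)) • innerSL ℝ (ξ - η)‖ ≤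
        (2 * Real.pi)⁻¹ * B * ((∫ z, k n z) + (((n:ℝ) + 1)⁻¹) ^ 2 * I) := by
    intro n ξ
    have hint0 := gain_integrable_kernelCLM hg hg0 0 ξ
    simp only [ne_eq, OfNat.ofNat_ne_zero, not_false_eq_true, zero_pow, add_zero] at hint0
    rw [← integral_sub hint0 (gain_integrable_kernelCLM hg hg0 _ ξ)]
    have hkξ : Integrable fun η => k n (ξ - η) := (hki n).comp_sub_left ξ
    have hbi : Integrable fun η : EuclideanSpace ℝ (Fin 2) => (2 * Real.pi)⁻¹ * B *
        (k n (ξ - η) + (((n:ℝ) + 1)⁻¹) ^ 2 * Real.exp (-(1 / 8) * ‖η‖ ^ 2)) :=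
      (hkξ.add (gain_integrable_exp.const_mul _)).const_mul _
    refine (norm_integral_le_of_norm_le hbi (Eventually.of_forall fun η => ?_)).trans (le_of_eq ?_)
    · rw [← sub_smul, ← mul_sub, gain_norm_smul_innerSL, abs_mul, mul_assoc, abs_sub_comm,
        gain_kernelReg_sub_kernel]
      have he1 : Real.exp (-(1 / 8) * ‖η‖ ^ 2) ≤ 1 := Real.exp_le_one_iff.2 (by nlinarith [norm_nonneg η])
      by_cases hz : ξ - η ∈ ball (0 : EuclideanSpace ℝ (Fin 2)) 1
      · have hkz : k n (ξ - η) = (((n:ℝ) + 1)⁻¹) ^ 2 / ((‖ξ - η‖ ^ 2 + (((n:ℝ) + 1)⁻¹) ^ 2) * ‖ξ - η‖) := by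
          simp only [hk, indicator_of_mem hz]
        have hg1 : |g η| ≤ B := (hg0 η).trans (mul_le_of_le_one_right hB he1)
        calc |g η| * ((2 * Real.pi)⁻¹ * ((((n:ℝ) + 1)⁻¹) ^ 2 / ((‖ξ - η‖ ^ 2 + (((n:ℝ) + 1)⁻¹) ^ 2) * ‖ξ - η‖)))
            ≤ B * ((2 * Real.pi)⁻¹ * ((((n:ℝ) + 1)⁻¹) ^ 2 / ((‖ξ - η‖ ^ 2 + (((n:ℝ) + 1)⁻¹) ^ 2) * ‖ξ - η‖))) :=
              mul_le_mul_of_nonneg_right hg1 (by positivity)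
          _ = (2 * Real.pi)⁻¹ * B * (k n (ξ - η) + 0) := by rw [hkz]; ring
          _ ≤ _ := by gcongr; positivity
      · have hkz : k n (ξ - η) = 0 := by simp only [hk, indicator_of_notMem hz]
        have h1 : 1 ≤ ‖ξ - η‖ := by simpa [mem_ball_zero_iff] using hz
        have hD : 1 ≤ (‖ξ - η‖ ^ 2 + (((n:ℝ) + 1)⁻¹) ^ 2) * ‖ξ - η‖ :=
          one_le_mul_of_one_le_of_one_le (by nlinarith [sq_nonneg (((n:ℝ) + 1)⁻¹)]) h1
        have hq : (((n:ℝ) + 1)⁻¹) ^ 2 / ((‖ξ - η‖ ^ 2 + (((n:ℝ) + 1)⁻¹) ^ 2) * ‖ξ - η‖) ≤ (((n:ℝ) + 1)⁻¹) ^ 2 :=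
          div_le_self (sq_nonneg _) hD
        calc |g η| * ((2 * Real.pi)⁻¹ * ((((n:ℝ) + 1)⁻¹) ^ 2 / ((‖ξ - η‖ ^ 2 + (((n:ℝ) + 1)⁻¹) ^ 2) * ‖ξ - η‖)))
            ≤ B * Real.exp (-(1 / 8) * ‖η‖ ^ 2) * ((2 * Real.pi)⁻¹ * (((n:ℝ) + 1)⁻¹) ^ 2) :=
              mul_le_mul (hg0 η) (by gcongr) (by positivity) (by positivity)
          _ = _ := by rw [hkz]; ring
    · rw [integral_const_mul, integral_add hkξ (gain_integrable_exp.const_mul _), integral_const_mul,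
        integral_sub_left_eq_self (k n) volume ξ]
  -- conclusion
  rw [Metric.tendstoUniformly_iff]
  intro e he
  have hlim : Tendsto (fun n : ℕ => (2 * Real.pi)⁻¹ * B * ((∫ z, k n z) + (((n:ℝ) + 1)⁻¹) ^ 2 * I))
      atTop (𝓝 0) := by
    have h := (hkt.add ((h0.pow 2).mul_const I)).const_mul ((2 * Real.pi)⁻¹ * B)
    simpa using h
  filter_upwards [(tendsto_order.1 hlim).2 e he] with n hn ξ
  rw [dist_eq_norm]
  exact (hmain n ξ).trans_lt hn

/-- **Pointwise convergence of the regularised potentials**: `ψ_{ε_n}(ξ) → ψ(ξ)` (dominated convergence: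
`|log(‖z‖² + ε²)| ≤ 2|log ‖z‖| + ‖z‖²` off the origin, `|log ‖ξ − η‖| ≤ L₀(ξ − η) + log(1 + ‖ξ‖) + ‖η‖`). [folklore] -/
theorem gain_tendsto_logRegPotential (ξ : EuclideanSpace ℝ (Fin 2)) :
    Tendsto (fun n : ℕ => ∫ η, (4 * Real.pi)⁻¹ * Real.log (‖ξ - η‖ ^ 2 + (((n:ℝ) + 1)⁻¹) ^ 2) * g η)
      atTop (𝓝 (∫ η, (2 * Real.pi)⁻¹ * Real.log ‖ξ - η‖ * g η)) := by
  -- adapted from the proof of `integral_logKernel_mul_fderiv_eq`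
  have hB : 0 ≤ B := (abs_nonneg _).trans ((hg0 0).trans (le_of_eq (by simp)))
  have hεn : ∀ n : ℕ, (0:ℝ) < ((n:ℝ) + 1)⁻¹ := fun n => by positivity
  have hεn1 : ∀ n : ℕ, ((n:ℝ) + 1)⁻¹ ≤ 1 := fun n =>
    inv_le_one_of_one_le₀ (by linarith [n.cast_nonneg (α := ℝ)])
  have h0 : Tendsto (fun n : ℕ => ((n:ℝ) + 1)⁻¹) atTop (𝓝 0) := by
    simpa [one_div] using tendsto_one_div_add_atTop_nhds_zero_nat (𝕜 := ℝ)
  have hae : ∀ᵐ η ∂(volume : Measure (EuclideanSpace ℝ (Fin 2))), η ≠ ξ := by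
    rw [ae_iff]
    simp
  set cξ : ℝ := Real.log (1 + ‖ξ‖) + ‖ξ‖ ^ 2 with hcξ
  have hcξ0 : 0 ≤ cξ := add_nonneg (Real.log_nonneg (by linarith [norm_nonneg ξ])) (sq_nonneg _)
  have hi0 : Integrable fun η : EuclideanSpace ℝ (Fin 2) =>
      (ball (0 : EuclideanSpace ℝ (Fin 2)) 1).indicator (fun z => -Real.log ‖z‖) (ξ - η) :=
    integrable_indicator_neg_log_norm.comp_sub_left ξ
  have hi2 := integrable_one_add_norm_pow_mul_exp_eighth 2
  refine tendsto_integral_of_dominated_convergence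
    (fun η => (4 * Real.pi)⁻¹ * (2 * B) *
      ((ball (0 : EuclideanSpace ℝ (Fin 2)) 1).indicator (fun z => -Real.log ‖z‖) (ξ - η) +
        (cξ + 1) * ((1 + ‖η‖) ^ 2 * Real.exp (-(1 / 8) * ‖η‖ ^ 2))))
    (fun n => (gain_integrable_logReg_mul hg hg0 (hεn n) ξ).aestronglyMeasurable)
    ((hi0.add (hi2.const_mul _)).const_mul _) (fun n => ?_) ?_
  · filter_upwards [hae] with η hη
    have hz : ξ - η ≠ 0 := sub_ne_zero.2 (Ne.symm hη)
    rw [Real.norm_eq_abs, abs_mul, abs_mul, abs_of_pos (by positivity : (0:ℝ) < (4 * Real.pi)⁻¹)]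
    have h1 := abs_log_normSq_add_sq_le_unif (hεn n) (hεn1 n) hz
    have h2 := abs_log_norm_sub_le ξ η
    have h4 := indicator_neg_log_norm_nonneg (ξ - η)
    have he : Real.exp (-(1 / 8) * ‖η‖ ^ 2) ≤ 1 := Real.exp_le_one_iff.2 (by nlinarith [norm_nonneg η])
    have he0 : 0 ≤ Real.exp (-(1 / 8) * ‖η‖ ^ 2) := (Real.exp_pos _).le
    set L0 := (ball (0 : EuclideanSpace ℝ (Fin 2)) 1).indicator (fun z => -Real.log ‖z‖) (ξ - η) with hL0
    set e := Real.exp (-(1 / 8) * ‖η‖ ^ 2) with he'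
    have h5 : 2 * |Real.log ‖ξ - η‖| + ‖ξ - η‖ ^ 2 ≤ 2 * L0 + 2 * (cξ + 1) * (1 + ‖η‖) ^ 2 := by
      have h3 : ‖ξ - η‖ ^ 2 ≤ 2 * ‖ξ‖ ^ 2 + 2 * ‖η‖ ^ 2 := by
        have ha : ‖ξ - η‖ ^ 2 ≤ (‖ξ‖ + ‖η‖) ^ 2 := pow_le_pow_left₀ (norm_nonneg _) (norm_sub_le ξ η) 2
        nlinarith [sq_nonneg (‖ξ‖ - ‖η‖)]
      have : Real.log (1 + ‖ξ‖) ≤ cξ := by simp only [hcξ]; nlinarith [norm_nonneg ξ]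
      nlinarith [norm_nonneg η, norm_nonneg ξ]
    calc (4 * Real.pi)⁻¹ * |Real.log (‖ξ - η‖ ^ 2 + (((n:ℝ) + 1)⁻¹) ^ 2)| * |g η|
        ≤ (4 * Real.pi)⁻¹ * (2 * L0 + 2 * (cξ + 1) * (1 + ‖η‖) ^ 2) * (B * e) := by
          gcongr
          · exact h1.trans h5
          · exact hg0 η
      _ = (4 * Real.pi)⁻¹ * (2 * B) * (L0 * e + (cξ + 1) * ((1 + ‖η‖) ^ 2 * e)) := by ring
      _ ≤ (4 * Real.pi)⁻¹ * (2 * B) * (L0 + (cξ + 1) * ((1 + ‖η‖) ^ 2 * e)) := by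
          gcongr; exact mul_le_of_le_one_right h4 he
  · filter_upwards [hae] with η hη
    have hz : ξ - η ≠ 0 := sub_ne_zero.2 (Ne.symm hη)
    have hn2 : (0:ℝ) < ‖ξ - η‖ ^ 2 := by positivity
    have hlim : Tendsto (fun n : ℕ => ‖ξ - η‖ ^ 2 + (((n:ℝ) + 1)⁻¹) ^ 2) atTop (𝓝 (‖ξ - η‖ ^ 2)) := by
      have := (h0.pow 2).const_add (‖ξ - η‖ ^ 2)
      rwa [zero_pow two_ne_zero, add_zero] at this
    have hlog := ((Real.continuousAt_log hn2.ne').tendsto.comp hlim).const_mul (4 * Real.pi)⁻¹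
    have he : (4 * Real.pi)⁻¹ * Real.log (‖ξ - η‖ ^ 2) = (2 * Real.pi)⁻¹ * Real.log ‖ξ - η‖ := by
      rw [Real.log_pow, Nat.cast_ofNat]; ring
    rw [he] at hlog
    exact hlog.mul_const _

end Density

/-! ### The registered helper -/

/-- **The derivative of the logarithmic potential of a bounded measurable density is gained from the kernel**:
for `g` measurable with `|g(η)| ≤ B e^{−‖η‖²/8}` and `ψ(ξ) = ∫ (2π)⁻¹ log ‖ξ − η‖ g(η) dη`, the Biot–Savart-type
integrand `g(η) DN(ξ − η)`, `DN(z) = (2π)⁻¹ (‖z‖²)⁻¹ ⟪z, ·⟫`, is integrable for every `ξ`, `ψ` has the Fréchet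
derivative `∫ g(η) DN(ξ − η) dη` at every `ξ`, and this derivative is continuous in `ξ` (registered helper toward
`logPotential_gain`; regularisation `N_ε = (4π)⁻¹ log(‖·‖² + ε²)`, uniform convergence of the regularised gradients,
`hasFDerivAt_of_tendstoUniformly`). [folklore] -/
theorem logPotential_gain_hasFDerivAt :
    ∀ (B : ℝ) (g : EuclideanSpace ℝ (Fin 2) → ℝ), Measurable g →
      (∀ η, |g η| ≤ B * Real.exp (-(1 / 8) * ‖η‖ ^ 2)) →
      (∀ ξ : EuclideanSpace ℝ (Fin 2), MeasureTheory.Integrable (fun η : EuclideanSpace ℝ (Fin 2) =>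
        (g η * ((2 * Real.pi)⁻¹ * (‖ξ - η‖ ^ 2)⁻¹)) • innerSL ℝ (ξ - η))) ∧
      (∀ ξ : EuclideanSpace ℝ (Fin 2),
        HasFDerivAt (fun ξ : EuclideanSpace ℝ (Fin 2) => ∫ η, (2 * Real.pi)⁻¹ * Real.log ‖ξ - η‖ * g η)
          (∫ η, (g η * ((2 * Real.pi)⁻¹ * (‖ξ - η‖ ^ 2)⁻¹)) • innerSL ℝ (ξ - η)) ξ) ∧
      Continuous (fun ξ : EuclideanSpace ℝ (Fin 2) => ∫ η,
        (g η * ((2 * Real.pi)⁻¹ * (‖ξ - η‖ ^ 2)⁻¹)) • innerSL ℝ (ξ - η)) := by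
  intro B g hg hg0
  have hεn : ∀ n : ℕ, (0:ℝ) < ((n:ℝ) + 1)⁻¹ := fun n => by positivity
  have hU := gain_tendstoUniformly_fderiv hg hg0
  refine ⟨fun ξ => ?_, fun ξ => ?_, ?_⟩
  · have h := gain_integrable_kernelCLM hg hg0 0 ξ
    simpa only [ne_eq, OfNat.ofNat_ne_zero, not_false_eq_true, zero_pow, add_zero] using h
  · exact hasFDerivAt_of_tendstoUniformly hU (fun n ξ => gain_hasFDerivAt_logReg hg hg0 (hεn n) ξ)
      (fun ξ => gain_tendsto_logRegPotential hg hg0 ξ) ξ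
  · exact hU.continuous (Frequently.of_forall fun n => gain_continuous_integral_kernelReg hg hg0 (hεn n))

end Summit.AnomalousDissipation.AnomalousDissipation.Theorems.MarginalStabilityChainStretchedVortexRows

end
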